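import Literature.MathematicalPhysics.QuantumLattice.KohnLuttingerLindhardL2Continuity
import HarnessLib

/-!
# `L²`-continuity in `μ` of the Lindhard kernel along the moving Fermi curve, II: Vitali in `p`, (K2')

Topic `Literature/MathematicalPhysics/QuantumLattice`; continues `KohnLuttingerLindhardL2Continuity`
(Minkowski on the difference of two polar Lindhard kernels; a.e.-`p` convergence of the sections).
Here, for `ε = squareDispersion 1 0` and a compact sub-band `[μ₁, μ₂] ⊂ (-4, 0)` on which the torus
sublevel estimate (TSL) and the shell-volume estimate (SV) hold uniformly:

* `tendsto_lintegral_eLpNorm_lindhardIntegrand_polar_sub` — Vitali in `p` along sequences `μ_n → μ₀`: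
  `∫_{BZ} ‖F_{μ_n}(·,p) - F_{μ₀}(·,p)‖_{L²(dz)} dp → 0` (uniform integrability by de la Vallée-Poussin
  from the uniform bound `lintegral_rpow_neg_energy_le`);
* `tendsto_eLpNorm_lindhardKernelPolar_sub` — **(K2') `‖χ₀(γ_μ·+γ_μ·; μ) - χ₀(γ_{μ₀}·+γ_{μ₀}·; μ₀)‖_{L²(dz)} → 0`
  as `μ → μ₀ ∈ (μ₁, μ₂)`**.

Everything is proved; no definitions. [cite: SteinSingularIntegrals1970, App. A.1]
-/

noncomputable section

open Real Set Filter MeasureTheory MeasureTheory.Measure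
open scoped Topology ENNReal NNReal

namespace Literature.MathematicalPhysics.QuantumLattice

/-! ### Vitali in `p`: `∫_{BZ} ‖F_{μ_n}(·,p) - F_{μ₀}(·,p)‖_{L²(dz)} dp → 0` -/

/-- `(max x y)^r ≤ x^r + y^r` for `x, y ≥ 0`, `r ≥ 0`. [folklore] -/
theorem max_rpow_le_add_rpow {x y r : ℝ} (hx : 0 ≤ x) (hy : 0 ≤ y) :
    (max x y) ^ r ≤ x ^ r + y ^ r := by
  rcases le_total x y with h | h
  · rw [max_eq_right h]; linarith [Real.rpow_nonneg hx r]
  · rw [max_eq_left h]; linarith [Real.rpow_nonneg hy r]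

/-- The `p ↦ ‖D(·, p)‖_{L²(dz)}` section norm of a jointly measurable `D` is measurable. [folklore] -/
theorem measurable_eLpNorm_two_section {α β' : Type*} [MeasurableSpace α] [MeasurableSpace β']
    {ν : Measure α} [SFinite ν] {D : α → β' → ℝ} (hD : Measurable (Function.uncurry D)) :
    Measurable fun p => eLpNorm (fun z => D z p) 2 ν := by
  have h : ∀ p, eLpNorm (fun z => D z p) 2 ν = (∫⁻ z, ‖D z p‖ₑ ^ (2 : ℝ) ∂ν) ^ (1 / (2 : ℝ)) := fun p => by
    rw [eLpNorm_eq_lintegral_rpow_enorm_toReal two_ne_zero ENNReal.ofNat_ne_top, ENNReal.toReal_ofNat]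
  simp_rw [h]
  have hsw : Measurable (Function.uncurry fun (p : β') (z : α) => ‖D z p‖ₑ ^ (2 : ℝ)) :=
    (hD.comp measurable_swap).enorm.pow_const _
  exact (hsw.lintegral_prod_right).pow_const _

/-- **Vitali in `p`.** Along a sequence of levels `μ_n → μ₀` in a compact sub-band `[μ₁, μ₂] ⊂ (-4,0)`
on which (TSL) and (SV) hold uniformly, `∫_{BZ} ‖F_{μ_n}(·,p) - F_{μ₀}(·,p)‖_{L²(dz)} dp → 0`:
the integrands converge to `0` for a.e. `p` (`tendsto_eLpNorm_lindhardIntegrand_polar_sub`) and are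
uniformly integrable by de la Vallée-Poussin, being dominated by
`K(|ε_p - μ_n|^{β/2-1} + |ε_p - μ₀|^{β/2-1})` whose `r`-th powers, `r(1 - β/2) < 1`, have uniformly
bounded integrals (`lintegral_rpow_neg_energy_le`). [folklore] -/
theorem tendsto_lintegral_eLpNorm_lindhardIntegrand_polar_sub {μ₁ μ₂ : ℝ} (hμ₁ : -4 < μ₁) (hμ₂ : μ₂ < 0)
    {C β Csh : ℝ} (hC : 0 ≤ C) (hβ0 : 0 < β) (hβ2 : β < 2) (hCsh : 0 ≤ Csh)
    (hTSL : ∀ μ ∈ Icc μ₁ μ₂, ∀ (p : Momentum) (s : ℝ), 0 < s →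
      ((volume.restrict (Ioc (-π) π)).prod (volume.restrict (Ioc (-π) π)))
        {z : ℝ × ℝ | |squareDispersion 1 0 (p + (fermiPolar μ z.1 + fermiPolar μ z.2)) - μ| < s} ≤
        ENNReal.ofReal (C * s ^ β))
    (hSV : ∀ μ ∈ Icc μ₁ μ₂, ∀ t : ℝ, 0 < t →
      volume (brillouinZone ∩ {p : Momentum | |squareDispersion 1 0 p - μ| < t}) ≤ ENNReal.ofReal (Csh * t))
    {μ₀ : ℝ} (hμ₀ : μ₀ ∈ Icc μ₁ μ₂) {μs : ℕ → ℝ} (hμs : ∀ n, μs n ∈ Icc μ₁ μ₂)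
    (hlim : Tendsto μs atTop (𝓝 μ₀)) :
    Tendsto (fun n => ∫⁻ p in brillouinZone, eLpNorm (fun z : ℝ × ℝ =>
        lindhardIntegrand (squareDispersion 1 0) (μs n) (fermiPolar (μs n) z.1 + fermiPolar (μs n) z.2) p -
        lindhardIntegrand (squareDispersion 1 0) μ₀ (fermiPolar μ₀ z.1 + fermiPolar μ₀ z.2) p) 2
      ((volume.restrict (Ioc (-π) π)).prod (volume.restrict (Ioc (-π) π)))) atTop (𝓝 0) := by
  set ν : Measure (ℝ × ℝ) := (volume.restrict (Ioc (-π) π)).prod (volume.restrict (Ioc (-π) π)) with hν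
  set P : Measure Momentum := volume.restrict brillouinZone with hP
  haveI : IsFiniteMeasure P := by
    rw [hP]; exact isFiniteMeasure_restrict.2 volume_brillouinZone_lt_top.ne
  have hb0 : -4 < μ₀ ∧ μ₀ < 0 := ⟨hμ₁.trans_le hμ₀.1, hμ₀.2.trans_lt hμ₂⟩
  have hbn : ∀ n, -4 < μs n ∧ μs n < 0 := fun n => ⟨hμ₁.trans_le (hμs n).1, (hμs n).2.trans_lt hμ₂⟩
  -- the section norms `e n p` and their real versions `H n p`
  set F : ℝ → (ℝ × ℝ) → Momentum → ℝ := fun μ z p =>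
    lindhardIntegrand (squareDispersion 1 0) μ (fermiPolar μ z.1 + fermiPolar μ z.2) p with hF
  have hFm : ∀ {μ : ℝ}, -4 < μ → μ < 0 → Measurable (Function.uncurry (F μ)) := fun h1 h2 =>
    measurable_lindhardIntegrand_polar h1 h2
  set e : ℕ → Momentum → ℝ≥0∞ := fun n p => eLpNorm (fun z => F (μs n) z p - F μ₀ z p) 2 ν with he
  have hem : ∀ n, Measurable (e n) := fun n =>
    measurable_eLpNorm_two_section (ν := ν) ((hFm (hbn n).1 (hbn n).2).sub (hFm hb0.1 hb0.2))
  set H : ℕ → Momentum → ℝ := fun n p => (e n p).toReal with hH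
  have hHm : ∀ n, AEStronglyMeasurable (H n) P := fun n => (hem n).ennreal_toReal.aestronglyMeasurable
  -- constants
  set K : ℝ := Real.sqrt (2 * C / (2 - β)) with hK
  have hK0 : 0 ≤ K := Real.sqrt_nonneg _
  set γ : ℝ := 1 - β / 2 with hγ
  have hγ0 : 0 < γ := by rw [hγ]; linarith
  have hγ1 : γ < 1 := by rw [hγ]; linarith
  set r : ℝ := (1 + γ⁻¹) / 2 with hr
  have hγinv : 1 < γ⁻¹ := (one_lt_inv₀ hγ0).2 hγ1
  have hr1 : 1 < r := by rw [hr]; linarith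
  have hγr0 : 0 < γ * r := mul_pos hγ0 (by linarith)
  have hγr1 : γ * r < 1 := by
    rw [hr]
    have : γ * ((1 + γ⁻¹) / 2) = (γ + 1) / 2 := by field_simp
    rw [this]; linarith
  -- the pointwise section bound off the level sets
  have hsec : ∀ {μ : ℝ}, μ ∈ Icc μ₁ μ₂ → ∀ p, squareDispersion 1 0 p ≠ μ →
      eLpNorm (fun z => F μ z p) 2 ν ≤ ENNReal.ofReal (K * |squareDispersion 1 0 p - μ| ^ (-γ)) := by
    intro μ hμ p hp
    have h := eLpNorm_lindhardIntegrand_polar_le (hμ₁.trans_le hμ.1) (hμ.2.trans_lt hμ₂) p hC hβ2 (hTSL μ hμ p) hp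
    rw [show -γ = β / 2 - 1 by rw [hγ]; ring]
    exact h
  -- the dominating family
  set B : ℕ → Momentum → ℝ := fun n p =>
    2 * K * max (|squareDispersion 1 0 p - μs n| ^ (-γ)) (|squareDispersion 1 0 p - μ₀| ^ (-γ)) with hB
  have hnull : ∀ μ : ℝ, ∀ᵐ p ∂P, squareDispersion 1 0 p ≠ μ := fun μ => by
    rw [hP]
    refine ae_restrict_of_ae ?_
    rw [ae_iff]
    simp only [not_not]
    exact volume_levelSet_squareDispersion μ
  have hH0 : ∀ n, ∀ᵐ p ∂P, 0 ≤ H n p := fun n => Eventually.of_forall fun p => ENNReal.toReal_nonneg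
  have he_le : ∀ n, ∀ᵐ p ∂P, e n p ≤ ENNReal.ofReal (K * |squareDispersion 1 0 p - μs n| ^ (-γ) +
      K * |squareDispersion 1 0 p - μ₀| ^ (-γ)) := fun n => by
    filter_upwards [hnull (μs n), hnull μ₀] with p hpn hp0
    have hsm1 : AEStronglyMeasurable (fun z => F (μs n) z p) ν :=
      ((hFm (hbn n).1 (hbn n).2).comp (measurable_id.prodMk measurable_const)).aestronglyMeasurable
    have hsm2 : AEStronglyMeasurable (fun z => F μ₀ z p) ν :=
      ((hFm hb0.1 hb0.2).comp (measurable_id.prodMk measurable_const)).aestronglyMeasurable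
    calc e n p ≤ eLpNorm (fun z => F (μs n) z p) 2 ν + eLpNorm (fun z => F μ₀ z p) 2 ν :=
          eLpNorm_sub_le hsm1 hsm2 one_le_two
      _ ≤ ENNReal.ofReal (K * |squareDispersion 1 0 p - μs n| ^ (-γ)) +
            ENNReal.ofReal (K * |squareDispersion 1 0 p - μ₀| ^ (-γ)) :=
          add_le_add (hsec (hμs n) p hpn) (hsec hμ₀ p hp0)
      _ = _ := (ENNReal.ofReal_add (mul_nonneg hK0 (Real.rpow_nonneg (abs_nonneg _) _))
            (mul_nonneg hK0 (Real.rpow_nonneg (abs_nonneg _) _))).symm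
  have hHB : ∀ n, ∀ᵐ p ∂P, H n p ≤ B n p := fun n => by
    filter_upwards [he_le n] with p hp
    have hx := Real.rpow_nonneg (abs_nonneg (squareDispersion 1 0 p - μs n)) (-γ)
    have hy := Real.rpow_nonneg (abs_nonneg (squareDispersion 1 0 p - μ₀)) (-γ)
    have hB0 : 0 ≤ B n p := by rw [hB]; positivity
    refine (ENNReal.toReal_le_of_le_ofReal (by positivity) hp).trans ?_
    show K * |squareDispersion 1 0 p - μs n| ^ (-γ) + K * |squareDispersion 1 0 p - μ₀| ^ (-γ) ≤
      2 * K * max (|squareDispersion 1 0 p - μs n| ^ (-γ)) (|squareDispersion 1 0 p - μ₀| ^ (-γ))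
    nlinarith [le_max_left (|squareDispersion 1 0 p - μs n| ^ (-γ)) (|squareDispersion 1 0 p - μ₀| ^ (-γ)),
      le_max_right (|squareDispersion 1 0 p - μs n| ^ (-γ)) (|squareDispersion 1 0 p - μ₀| ^ (-γ))]
  -- uniform bound on `∫ (B n)^r`
  set S : ℝ≥0∞ := volume brillouinZone + ENNReal.ofReal (Csh * ((γ * r)⁻¹ - 1)⁻¹) with hS
  have hSfin : S ≠ ⊤ := ENNReal.add_ne_top.2 ⟨volume_brillouinZone_lt_top.ne, ENNReal.ofReal_ne_top⟩
  have hε : Continuous (squareDispersion 1 0) := by unfold squareDispersion; fun_prop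
  have hmeasPow : ∀ μ : ℝ, Measurable fun p : Momentum => ENNReal.ofReal (|squareDispersion 1 0 p - μ| ^ (-(γ * r))) :=
    fun μ => ENNReal.measurable_ofReal.comp (((hε.sub continuous_const).abs.measurable).pow_const _)
  have hBint : ∀ n, ∫⁻ p, ENNReal.ofReal (B n p ^ r) ∂P ≤ ENNReal.ofReal ((2 * K) ^ r) * (S + S) := fun n => by
    have hpt : ∀ p, ENNReal.ofReal (B n p ^ r) ≤ ENNReal.ofReal ((2 * K) ^ r) *
        (ENNReal.ofReal (|squareDispersion 1 0 p - μs n| ^ (-(γ * r))) +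
          ENNReal.ofReal (|squareDispersion 1 0 p - μ₀| ^ (-(γ * r)))) := fun p => by
      have hx := Real.rpow_nonneg (abs_nonneg (squareDispersion 1 0 p - μs n)) (-γ)
      have hy := Real.rpow_nonneg (abs_nonneg (squareDispersion 1 0 p - μ₀)) (-γ)
      rw [← ENNReal.ofReal_add (Real.rpow_nonneg (abs_nonneg _) _) (Real.rpow_nonneg (abs_nonneg _) _),
        ← ENNReal.ofReal_mul (Real.rpow_nonneg (by positivity) _)]
      refine ENNReal.ofReal_le_ofReal ?_
      rw [hB]
      rw [Real.mul_rpow (by positivity) (le_max_of_le_left hx)]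
      refine mul_le_mul_of_nonneg_left ?_ (Real.rpow_nonneg (by positivity) _)
      refine (max_rpow_le_add_rpow hx hy).trans (le_of_eq ?_)
      rw [← Real.rpow_mul (abs_nonneg _), ← Real.rpow_mul (abs_nonneg _), neg_mul]
    calc ∫⁻ p, ENNReal.ofReal (B n p ^ r) ∂P
        ≤ ∫⁻ p, ENNReal.ofReal ((2 * K) ^ r) *
          (ENNReal.ofReal (|squareDispersion 1 0 p - μs n| ^ (-(γ * r))) +
            ENNReal.ofReal (|squareDispersion 1 0 p - μ₀| ^ (-(γ * r)))) ∂P := lintegral_mono hpt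
      _ = ENNReal.ofReal ((2 * K) ^ r) *
          ((∫⁻ p, ENNReal.ofReal (|squareDispersion 1 0 p - μs n| ^ (-(γ * r))) ∂P) +
            ∫⁻ p, ENNReal.ofReal (|squareDispersion 1 0 p - μ₀| ^ (-(γ * r))) ∂P) := by
          rw [lintegral_const_mul' _ _ ENNReal.ofReal_ne_top, lintegral_add_left (hmeasPow _)]
      _ ≤ ENNReal.ofReal ((2 * K) ^ r) * (S + S) := by
          refine mul_le_mul_right (add_le_add ?_ ?_) _
          · exact lintegral_rpow_neg_energy_le hγr0 hγr1 hCsh (hSV (μs n) (hμs n))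
          · exact lintegral_rpow_neg_energy_le hγr0 hγr1 hCsh (hSV μ₀ hμ₀)
  have hUI : UnifIntegrable H 1 P :=
    unifIntegrable_of_dominated_rpow hHm hH0 hHB hr1
      (ENNReal.mul_ne_top ENNReal.ofReal_ne_top (ENNReal.add_ne_top.2 ⟨hSfin, hSfin⟩)) hBint
  -- a.e. convergence of `H n p` to `0`
  have hHlim : ∀ᵐ p ∂P, Tendsto (fun n => H n p) atTop (𝓝 0) := by
    filter_upwards [hnull μ₀] with p hp
    have h := tendsto_eLpNorm_lindhardIntegrand_polar_sub hb0.1 hb0.2 hβ0 (hTSL μ₀ hμ₀)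
      (fun n => ⟨(hbn n).1, (hbn n).2⟩) hlim hp
    have h2 := (ENNReal.tendsto_toReal ENNReal.zero_ne_top).comp h
    rwa [ENNReal.toReal_zero] at h2
  -- Vitali
  have hV := tendsto_Lp_finite_of_tendsto_ae (μ := P) le_rfl ENNReal.one_ne_top hHm
    (MemLp.zero' (ε := ℝ)) hUI hHlim
  -- `‖H n‖_{L¹} = ∫ e n`
  have hid : ∀ n, eLpNorm (H n - fun _ => (0 : ℝ)) 1 P = ∫⁻ p, e n p ∂P := fun n => by
    rw [eLpNorm_one_eq_lintegral_enorm]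
    refine lintegral_congr_ae ?_
    filter_upwards [he_le n] with p hp
    rw [Pi.sub_apply, sub_zero, hH]
    simp only
    rw [Real.enorm_eq_ofReal ENNReal.toReal_nonneg, ENNReal.ofReal_toReal (hp.trans_lt ENNReal.ofReal_lt_top).ne]
  simp_rw [hid] at hV
  exact hV

/-! ### (K2') `L²(dz)`-continuity in `μ` of the polar Lindhard kernel -/

/-- **(K2') The polar Lindhard kernel is `L²(dθdθ')`-continuous in the level**: on a compact sub-band
`[μ₁, μ₂] ⊂ (-4, 0)` on which the torus sublevel estimate (TSL) and the shell-volume estimate (SV)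
hold uniformly, `‖χ₀(γ_μ· + γ_μ·; μ) - χ₀(γ_{μ₀}· + γ_{μ₀}·; μ₀)‖_{L²(dz)} → 0` as `μ → μ₀ ∈ (μ₁, μ₂)`
(Minkowski on the difference, `eLpNorm_lindhardKernelPolar_sub_le`, then Vitali in `p`,
`tendsto_lintegral_eLpNorm_lindhardIntegrand_polar_sub`, along sequences).
[cite: SteinSingularIntegrals1970, App. A.1] -/
theorem tendsto_eLpNorm_lindhardKernelPolar_sub {μ₁ μ₂ : ℝ} (hμ₁ : -4 < μ₁) (hμ₂ : μ₂ < 0)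
    {C β Csh : ℝ} (hC : 0 ≤ C) (hβ0 : 0 < β) (hβ2 : β < 2) (hCsh : 0 ≤ Csh)
    (hTSL : ∀ μ ∈ Icc μ₁ μ₂, ∀ (p : Momentum) (s : ℝ), 0 < s →
      ((volume.restrict (Ioc (-π) π)).prod (volume.restrict (Ioc (-π) π)))
        {z : ℝ × ℝ | |squareDispersion 1 0 (p + (fermiPolar μ z.1 + fermiPolar μ z.2)) - μ| < s} ≤
        ENNReal.ofReal (C * s ^ β))
    (hSV : ∀ μ ∈ Icc μ₁ μ₂, ∀ t : ℝ, 0 < t →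
      volume (brillouinZone ∩ {p : Momentum | |squareDispersion 1 0 p - μ| < t}) ≤ ENNReal.ofReal (Csh * t))
    {μ₀ : ℝ} (hμ₀ : μ₀ ∈ Ioo μ₁ μ₂) :
    Tendsto (fun μ => eLpNorm (fun z : ℝ × ℝ =>
        lindhardFunction (squareDispersion 1 0) μ (fermiPolar μ z.1 + fermiPolar μ z.2) -
        lindhardFunction (squareDispersion 1 0) μ₀ (fermiPolar μ₀ z.1 + fermiPolar μ₀ z.2)) 2
      ((volume.restrict (Ioc (-π) π)).prod (volume.restrict (Ioc (-π) π)))) (𝓝 μ₀) (𝓝 0) := by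
  classical
  have hμ₀' : μ₀ ∈ Icc μ₁ μ₂ := Ioo_subset_Icc_self hμ₀
  have hb0 : -4 < μ₀ ∧ μ₀ < 0 := ⟨hμ₁.trans_le hμ₀'.1, hμ₀'.2.trans_lt hμ₂⟩
  rw [tendsto_iff_seq_tendsto]
  intro μs hμs
  -- modify the sequence outside `[μ₁, μ₂]` (an eventually-irrelevant change)
  set μs' : ℕ → ℝ := fun n => if μs n ∈ Icc μ₁ μ₂ then μs n else μ₀ with hμs'
  have hmem : ∀ n, μs' n ∈ Icc μ₁ μ₂ := fun n => by
    simp only [hμs']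
    split_ifs with h
    · exact h
    · exact hμ₀'
  have hev : ∀ᶠ n in atTop, μs' n = μs n := by
    filter_upwards [hμs.eventually (Icc_mem_nhds hμ₀.1 hμ₀.2)] with n hn
    have hn' : μs n ∈ Icc μ₁ μ₂ := hn
    simp only [hμs']
    rw [if_pos hn']
  have hlim' : Tendsto μs' atTop (𝓝 μ₀) := hμs.congr' (hev.mono fun n hn => hn.symm)
  have hbn : ∀ n, -4 < μs' n ∧ μs' n < 0 := fun n => ⟨hμ₁.trans_le (hmem n).1, (hmem n).2.trans_lt hμ₂⟩
  -- the bound along `μs'`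
  have hle : ∀ n, eLpNorm (fun z : ℝ × ℝ =>
        lindhardFunction (squareDispersion 1 0) (μs' n) (fermiPolar (μs' n) z.1 + fermiPolar (μs' n) z.2) -
        lindhardFunction (squareDispersion 1 0) μ₀ (fermiPolar μ₀ z.1 + fermiPolar μ₀ z.2)) 2
        ((volume.restrict (Ioc (-π) π)).prod (volume.restrict (Ioc (-π) π))) ≤
      ENNReal.ofReal (((2 * π) ^ 2)⁻¹) * ∫⁻ p in brillouinZone, eLpNorm (fun z : ℝ × ℝ =>
        lindhardIntegrand (squareDispersion 1 0) (μs' n) (fermiPolar (μs' n) z.1 + fermiPolar (μs' n) z.2) p -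
        lindhardIntegrand (squareDispersion 1 0) μ₀ (fermiPolar μ₀ z.1 + fermiPolar μ₀ z.2) p) 2
        ((volume.restrict (Ioc (-π) π)).prod (volume.restrict (Ioc (-π) π))) := fun n =>
    eLpNorm_lindhardKernelPolar_sub_le (hbn n).1 (hbn n).2 hb0.1 hb0.2 hC hβ0 hβ2 hCsh hC hβ0 hβ2 hCsh
      (hTSL _ (hmem n)) (hSV _ (hmem n)) (hTSL _ hμ₀') (hSV _ hμ₀')
  have hV := tendsto_lintegral_eLpNorm_lindhardIntegrand_polar_sub hμ₁ hμ₂ hC hβ0 hβ2 hCsh hTSL hSV hμ₀'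
    hmem hlim'
  have hupper := ENNReal.Tendsto.const_mul hV (Or.inr ENNReal.ofReal_ne_top) (a := ENNReal.ofReal (((2 * π) ^ 2)⁻¹))
  rw [mul_zero] at hupper
  have hseq := tendsto_of_tendsto_of_tendsto_of_le_of_le tendsto_const_nhds hupper (fun n => bot_le) hle
  refine hseq.congr' ?_
  filter_upwards [hev] with n hn
  simp only [Function.comp_apply, hn]

end Literature.MathematicalPhysics.QuantumLattice

end
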